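import Summits.AnomalousDissipation.AnomalousDissipation.Theses.FrustratedForces
import Literature.Analysis.FluidPDE.DoeringFoiasPowerProofs
import Literature.Analysis.FluidPDE.NSHopfExistenceProofs
import Literature.Analysis.FluidPDE.LerayHopfSpectralMeasurability
import Literature.Analysis.FunctionSpaces.TorusFluidGlueProofs
import Literature.Analysis.FunctionSpaces.TorusTrigPoly

/-!
# Refutation of `FrustratedForces.GPEnergyCeiling` (stmt-AnomalousDissipation-2979): data of any mean

`GPEnergyCeiling` (route `AnomalousDissipation/FrustratedForces`, crux rank 3) asks for ONE constant `E`
bounding the long-time mean energy `meanEnergy u = limsup_T T⁻¹∫₀ᵀ‖u‖₂²` of EVERY global Leray–Hopf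
solution of NS_ν forced by the Galloway–Proctor/Archontis force `f_GP`, for every `ν ∈ (0,1]` and EVERY
`L²` datum `u₀`. The datum is not asked to have zero mean, while `f_GP` has zero mean, so the mean flow
`∫ u(t) = ∫ u₀` is conserved (`Torus.IsGlobalLerayHopf.integral_inner_const_eq`, proved in tree). For the
constant datum `u₀ ≡ m` Hopf's theorem (`hopf_existence_torus_holds`, proved in tree) gives a global
Leray–Hopf solution; by Cauchy–Schwarz on the unit-volume torus `‖u(t)‖₂² ≥ ‖m‖²` for every `t > 0`, the
Cesàro means of the energy are bounded (`Torus.IsGlobalLerayHopf.timeMean_norm_sq_le`, the Doering–Foias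
a-priori estimate, proved in tree) so the `limsup` is honest, whence `meanEnergy u ≥ ‖m‖²`, unbounded in
`m`. Witness for a given `E`: `ν = 1`, `m = (max E 0 + 1) e₀`.
FIX (planner restate, already prepared as SketchV2 on the item): add `Torus.HasZeroMean u₀ →`
(and `∀ j, HasZeroMean (u₀ j)` in `GPLoudFamily`, the Assembly and `EnsembleCeilingBridge` alike).
All auxiliary facts are `have`s inside the single theorem (refuter files carry negations only).
Route review 2026-08-15, refuter-rreview-route-NavierStokesRegula-dc168335-0.
The refuted decl was then dropped from the route (zero-mean repair); it is re-created privately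
below, so the theorem's (append-only) statement is unchanged and nothing depends on the retired
route name.
-/

/-- PRIVATE re-creation (route namespace stays free; a refuted statement, NOT a cited fact) of the
route decl `…Theses.FrustratedForces.GPEnergyCeiling`, stmt-AnomalousDissipation-2979, DROPPED from the
route at its repair (2026-08-15T16:20:59Z; zero-mean successors `GPEnergyCeilingZ` → `GPLoudEnergyCeilingZ`)
after the refutation below, so the name left `Theses/FrustratedForces.lean` (full-build breakage
2026-08-16, `Unknown identifier`): the item's recorded signature verbatim, so that the append-only
refuting theorem keeps elaborating. -/
private def Summit.AnomalousDissipation.AnomalousDissipation.Theses.FrustratedForces.GPEnergyCeiling :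
    Prop :=
  ∃ E : ℝ, ∀ ν : ℝ, 0 < ν → ν ≤ 1 →
    ∀ (u₀ : UnitAddTorus (Fin 3) → EuclideanSpace ℝ (Fin 3))
      (u : ℝ → UnitAddTorus (Fin 3) → EuclideanSpace ℝ (Fin 3)),
      Literature.Analysis.FluidPDE.Torus.IsGlobalLerayHopf ν (fun _ => (fun x : UnitAddTorus (Fin 3) =>
        (Literature.Analysis.FluidPDE.Torus.stokesMode (Pi.single (2 : Fin 3) (1 : ℤ))
            (EuclideanSpace.single (0 : Fin 3) (1 : ℝ)) false x +
          Literature.Analysis.FluidPDE.Torus.stokesMode (Pi.single (0 : Fin 3) (1 : ℤ))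
            (EuclideanSpace.single (1 : Fin 3) (1 : ℝ)) false x +
          Literature.Analysis.FluidPDE.Torus.stokesMode (Pi.single (1 : Fin 3) (1 : ℤ))
            (EuclideanSpace.single (2 : Fin 3) (1 : ℝ)) false x : EuclideanSpace ℝ (Fin 3)))) u₀ u →
      Literature.Analysis.FluidPDE.meanEnergy u ≤ E

namespace Summit.AnomalousDissipation.AnomalousDissipation.Theorems

open scoped BigOperators Topology ENNReal InnerProductSpace RealInnerProductSpace
open Filter Set MeasureTheory UnitAddTorus
open Literature.Analysis Literature.Analysis.FunctionSpaces Literature.Analysis.FluidPDE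

/-- Refutes `FrustratedForces.GPEnergyCeiling` (stmt-AnomalousDissipation-2979): no constant `E`
bounds `meanEnergy u` over all data, because the Galloway–Proctor force has zero mean, the mean flow
is conserved, and Hopf's theorem supplies a global Leray–Hopf solution from the constant datum
`m = (max E 0 + 1) e₀` at `ν = 1`, whose mean energy is `≥ ‖m‖² > E`; witness: Galilean drift of
the datum. [folklore] -/
theorem FrustratedForcesGPEnergyCeiling_refuted :
    ¬ Summit.AnomalousDissipation.AnomalousDissipation.Theses.FrustratedForces.GPEnergyCeiling := by
  rintro ⟨E, hE⟩
  /- (1) Stokes eigenfields are smooth. -/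
  have isSmooth_mode : ∀ (k : Fin 3 → ℤ) (a : EuclideanSpace ℝ (Fin 3)) (c : Bool),
      Torus.IsSmooth (fun x : UnitAddTorus (Fin 3) =>
        (Torus.stokesMode k a c x : EuclideanSpace ℝ (Fin 3))) := by
    intro k a c
    cases c
    · simp only [Torus.stokesMode_apply, Bool.false_eq_true, ↓reduceIte]
      exact ((Torus.isSmooth_mFourier k).comp_clm Complex.imCLM).smul' (Torus.isSmooth_const a)
    · simp only [Torus.stokesMode_apply, ↓reduceIte]
      exact ((Torus.isSmooth_mFourier k).comp_clm Complex.reCLM).smul' (Torus.isSmooth_const a)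
  /- (2) Stokes eigenfields with nonzero frequency have zero mean. -/
  have hasZeroMean_mode : ∀ {k : Fin 3 → ℤ}, k ≠ 0 → ∀ (a : EuclideanSpace ℝ (Fin 3)) (c : Bool),
      Torus.HasZeroMean (fun x : UnitAddTorus (Fin 3) =>
        (Torus.stokesMode k a c x : EuclideanSpace ℝ (Fin 3))) := by
    intro k hk a c
    have hint : Integrable (⇑(mFourier k) : UnitAddTorus (Fin 3) → ℂ) volume :=
      (Torus.isSmooth_mFourier k).integrable
    have hmean : ∫ x : UnitAddTorus (Fin 3), mFourier k x = 0 := by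
      rw [Torus.integral_mFourier, if_neg hk]
    unfold Torus.HasZeroMean
    simp only [Torus.stokesMode_apply]
    rw [integral_smul_const]
    cases c
    · simp only [Bool.false_eq_true, ↓reduceIte]
      have h := Complex.imCLM.integral_comp_comm hint
      simp only [Complex.imCLM_apply] at h
      rw [h, hmean, Complex.zero_im, zero_smul]
    · simp only [↓reduceIte]
      have h := Complex.reCLM.integral_comp_comm hint
      simp only [Complex.reCLM_apply] at h
      rw [h, hmean, Complex.zero_re, zero_smul]
  /- (3) Zero mean is additive (three integrable summands). -/
  have hasZeroMean_add₃ : ∀ {a b c : UnitAddTorus (Fin 3) → EuclideanSpace ℝ (Fin 3)},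
      Integrable a volume → Integrable b volume → Integrable c volume →
      Torus.HasZeroMean a → Torus.HasZeroMean b → Torus.HasZeroMean c →
      Torus.HasZeroMean (fun x => a x + b x + c x) := by
    intro a b c ha hb hc ha0 hb0 hc0
    unfold Torus.HasZeroMean at ha0 hb0 hc0 ⊢
    have e1 : ∫ x, (a x + b x + c x) = (∫ x, (a x + b x)) + ∫ x, c x := integral_add (ha.add hb) hc
    have e2 : ∫ x, (a x + b x) = (∫ x, a x) + ∫ x, b x := integral_add ha hb
    rw [e1, e2, ha0, hb0, hc0, add_zero, add_zero]
  /- (4) Large-mean Leray–Hopf flows have large mean energy: for `ν > 0`, a steady smooth mean-zero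
  force `f` and a global Leray–Hopf solution `u` from the CONSTANT datum `x ↦ m`, `‖m‖² ≤ meanEnergy u`. -/
  have key : ∀ {ν : ℝ}, 0 < ν → ∀ {f : UnitAddTorus (Fin 3) → EuclideanSpace ℝ (Fin 3)},
      Torus.IsSmooth f → Torus.HasZeroMean f → ∀ (m : EuclideanSpace ℝ (Fin 3))
      {u : ℝ → UnitAddTorus (Fin 3) → EuclideanSpace ℝ (Fin 3)},
      Torus.IsGlobalLerayHopf ν (fun _ => f) (fun _ => m) u → ‖m‖ ^ 2 ≤ meanEnergy u := by
    intro ν hν f hf hf0 m u hu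
    set g : ℝ → ℝ := fun t => ∫ x, ‖u t x‖ ^ 2 with hg
    -- Step 1: every slice at a positive time carries at least the energy of the mean flow.
    have hslice : ∀ t : ℝ, 0 < t → ‖m‖ ^ 2 ≤ g t := by
      intro t ht
      have hmean : ∫ x, ⟪u t x, m⟫ = ‖m‖ ^ 2 := by
        rw [hu.integral_inner_const_eq hf hf0 m ht]
        simp [integral_const]
      have hcs := abs_integral_inner_le_sqrt_mul_sqrt (hu.memLp_two ht.le)
        (memLp_const m : MemLp (fun _ : UnitAddTorus (Fin 3) => m) 2 volume)
      rw [hmean] at hcs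
      have hconst : (∫ _x : UnitAddTorus (Fin 3), ‖m‖ ^ 2) = ‖m‖ ^ 2 := by
        simp [integral_const]
      rw [hconst, Real.sqrt_sq (norm_nonneg _), abs_of_nonneg (sq_nonneg _)] at hcs
      have hg0 : 0 ≤ g t := integral_nonneg fun _ => sq_nonneg _
      by_cases hm : m = 0
      · simp [hm, hg0]
      · have hmpos : 0 < ‖m‖ := norm_pos_iff.2 hm
        have h1 : ‖m‖ ≤ Real.sqrt (g t) := by
          have : ‖m‖ * ‖m‖ ≤ Real.sqrt (g t) * ‖m‖ := by rw [← sq]; exact hcs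
          exact le_of_mul_le_mul_right this hmpos
        calc ‖m‖ ^ 2 ≤ Real.sqrt (g t) ^ 2 := by gcongr
          _ = g t := Real.sq_sqrt hg0
    -- Step 2: the Cesàro means are at least `‖m‖²`.
    have hmeans : ∀ T : ℝ, 0 < T → ‖m‖ ^ 2 ≤ timeMean g T := by
      intro T hT
      have hint : IntegrableOn g (Ioc 0 T) := hu.integrableOn_integral_norm_sq hT
      have hmono : ∫ t in Ioc 0 T, ‖m‖ ^ 2 ≤ ∫ t in Ioc 0 T, g t :=
        setIntegral_mono_on (integrableOn_const (by simp)) hint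
          measurableSet_Ioc fun t ht => hslice t ht.1
      have hc : ∫ _t in Ioc 0 T, ‖m‖ ^ 2 = T * ‖m‖ ^ 2 := by
        rw [setIntegral_const, Real.volume_real_Ioc_of_le hT.le, sub_zero, smul_eq_mul]
      unfold timeMean
      rw [intervalIntegral.integral_of_le hT.le]
      rw [hc] at hmono
      calc ‖m‖ ^ 2 = T⁻¹ * (T * ‖m‖ ^ 2) := by field_simp
        _ ≤ T⁻¹ * ∫ t in Ioc 0 T, g t := by gcongr
    -- Step 3: the Cesàro means are bounded above (Doering–Foias), so the `limsup` is honest.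
    have hbdd : IsBoundedUnder (· ≤ ·) atTop (timeMean g) :=
      isBoundedUnder_of_eventually_le
        (eventually_atTop.2 ⟨1, fun T hT => hu.timeMean_norm_sq_le hν hf hf0 hT⟩)
    have hfreq : ∃ᶠ T in atTop, ‖m‖ ^ 2 ≤ timeMean g T :=
      ((eventually_gt_atTop 0).mono fun T hT => hmeans T hT).frequently
    rw [meanEnergy_eq_longTimeAvgSup]
    exact le_limsup_of_frequently_le hfreq hbdd
  /- (5) The Galloway–Proctor force is smooth and has zero mean. -/
  have hk2 : (Pi.single (2 : Fin 3) (1 : ℤ) : Fin 3 → ℤ) ≠ 0 := by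
    intro h; have := congr_fun h 2; simp at this
  have hk0 : (Pi.single (0 : Fin 3) (1 : ℤ) : Fin 3 → ℤ) ≠ 0 := by
    intro h; have := congr_fun h 0; simp at this
  have hk1 : (Pi.single (1 : Fin 3) (1 : ℤ) : Fin 3 → ℤ) ≠ 0 := by
    intro h; have := congr_fun h 1; simp at this
  have hFs : Torus.IsSmooth (fun x : UnitAddTorus (Fin 3) =>
      (Torus.stokesMode (Pi.single (2 : Fin 3) (1 : ℤ)) (EuclideanSpace.single (0 : Fin 3) (1 : ℝ)) false x +
        Torus.stokesMode (Pi.single (0 : Fin 3) (1 : ℤ)) (EuclideanSpace.single (1 : Fin 3) (1 : ℝ)) false x +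
        Torus.stokesMode (Pi.single (1 : Fin 3) (1 : ℤ)) (EuclideanSpace.single (2 : Fin 3) (1 : ℝ)) false x :
        EuclideanSpace ℝ (Fin 3))) :=
    ((isSmooth_mode _ _ false).add (isSmooth_mode _ _ false)).add (isSmooth_mode _ _ false)
  have hF0 : Torus.HasZeroMean (fun x : UnitAddTorus (Fin 3) =>
      (Torus.stokesMode (Pi.single (2 : Fin 3) (1 : ℤ)) (EuclideanSpace.single (0 : Fin 3) (1 : ℝ)) false x +
        Torus.stokesMode (Pi.single (0 : Fin 3) (1 : ℤ)) (EuclideanSpace.single (1 : Fin 3) (1 : ℝ)) false x +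
        Torus.stokesMode (Pi.single (1 : Fin 3) (1 : ℤ)) (EuclideanSpace.single (2 : Fin 3) (1 : ℝ)) false x :
        EuclideanSpace ℝ (Fin 3))) :=
    hasZeroMean_add₃ (isSmooth_mode _ _ false).integrable (isSmooth_mode _ _ false).integrable
      (isSmooth_mode _ _ false).integrable
      (hasZeroMean_mode hk2 (EuclideanSpace.single (0 : Fin 3) (1 : ℝ)) false)
      (hasZeroMean_mode hk0 (EuclideanSpace.single (1 : Fin 3) (1 : ℝ)) false)
      (hasZeroMean_mode hk1 (EuclideanSpace.single (2 : Fin 3) (1 : ℝ)) false)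
  /- (6) The datum: a constant drift `m` with `‖m‖² > E`; Hopf's theorem at `ν = 1`. -/
  set c : ℝ := max E 0 + 1 with hc
  have hc1 : 1 ≤ c := by rw [hc]; linarith [le_max_right E 0]
  have hcE : E < c := by rw [hc]; linarith [le_max_left E 0]
  set m : EuclideanSpace ℝ (Fin 3) := EuclideanSpace.single (0 : Fin 3) c with hm
  have hnorm : ‖m‖ = c := by
    rw [hm, PiLp.norm_single, Real.norm_eq_abs, abs_of_pos (by linarith)]
  have hmE : E < ‖m‖ ^ 2 := by
    rw [hnorm]; nlinarith
  obtain ⟨u, hu⟩ := hopf_existence_torus_holds 1 one_pos (fun _ => m)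
    (memLp_const m)
    (Torus.IsDivFree.isWeaklyDivFree_holds (Torus.isSmooth_const m) (isDivFree_fun_const m))
    (fun _ => _)
    (aestronglyMeasurable_stLift_steady hFs.continuous _)
    (fun T _ => lintegral_Ioo_lintegral_enorm_sq_steady_lt_top (hFs.memLp 2) T)
  have h1 := hE 1 one_pos le_rfl (fun _ => m) u hu
  have h2 := key one_pos hFs hF0 m hu
  linarith

end Summit.AnomalousDissipation.AnomalousDissipation.Theorems
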